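import Literature.MathematicalPhysics.QuantumFieldTheory.Balaban1983to89.B3Graph24Unique
import Literature.MathematicalPhysics.QuantumFieldTheory.Balaban1983to89.B3Cor23ConcreteTwoDim

/-!
# `Balaban1983to89.B3PropagatorChains433` — T. Bałaban, *(Higgs)₂,₃ quantum fields in a finite volume. III. Renormalization*,
Commun. Math. Phys. **88** (1983) 411–445 [Balaban1983Higgs3]: p. 433, the CHAINS OF PROPAGATORS created by the expansion of a
propagator in the fluctuation `B′` of the background field — *"For such chains, every subgraph has positive degree or contains
(2.4)"* — DECIDED on the concrete family of graphs `B3Cor23Concrete.Graph`, in every dimension `d` (file 1 of 2: the degree of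
every graph with the incidence of a chain; file 2 `…B3PropagatorChains433Model` = the concrete chains and their sub-chains)

statement-level skeleton of published theorems with citation tags; proofs where landed; nothing here is a claim about the Yang–Mills mass gap

PDF held: `paper:balaban1983-higgs-2-3-quantum-fields-finite-volume` (journal page = PDF page + 410); p. 433 [PDF 23] read on the
OCR text and on the ×2 render `run/shared/lean/pub/pub-balaban/b2b-balaban-ref1/pages/1983-cmp88-higgs23-III/1983-cmp88-higgs23-III-p023-x2.png`;
pp. 413–414 (the catalogue (1.8)–(1.15)), 422–424 ((2.1)–(2.4)) as read by the files imported.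
CITATION HEADER (lean-in-tree rule).  lit-balaban TYPED SKELETON (HOME `run/shared/lean/pub/lit-balaban/`), Phase 2, seat p18
(gen 6), unit `lit-balaban-p18`: SKELETON row **B3.Txt@433** (*"p. 433, the reduction steps"*, status `absent` in ROWS-B3 v1.45,
owner r15, referee ref-4) — the one sentence of the p. 433 narrative that is a statement about GRAPHS.  p. 433 [PDF 23], verbatim:
*"We have B̃ = B₀ + B′, and we expand in B′ the expressions connected with each renormalized class of graphs using the formulas
(I.3.14), (I.3.44), and (I.3.45). After this expansion we get a sum of expressions corresponding to some new big set of graphs,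
which can be decomposed into a sum of renormalized classes. … If a class does not contain any old vertex, then it is created by
an expansion of a propagator G_k(□, B̃) and it consists of one graph having the form of a chain of propagators G_k(□, B₀), with
vertices of the form (1.8)–(1.11) and (1.13)–(1.15) with external vector field B′ only. For such chains, every subgraph has
positive degree or contains (2.4), and the estimate (3.2) for them is a consequence of Proposition 2.1."*  Model:
`B3Cor23Concrete` (seat p18 gen 1): graphs of admissible catalogue vertices (1.6)–(1.15), internal lines = the pairing «other
endpoint» of φ′/A′-legs, D_G(v) = (2.1), D(G) = (2.2); the graph (2.4) of the model and its uniqueness among the divergent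
four-leg graphs: `B3Graph24Unique` (seat p18 gen 2); the hypothesis of Proposition 2.1 in exactly this shape («each connected
subgraph is (2.4) or has positive degree»): r15's `B3Prop1.PosSubgraphsExcept24`.

A CHAIN IN THE MODEL.  A chain of propagators with `m ≥ 1` lines has `m + 1` vertices of the form (1.8)–(1.11) (`isChainVertex`;
two φ′-legs each, p. 413), consecutive vertices joined by ONE scalar line (the propagator G_k(□, B₀)), the two end φ′-legs external
(the ends of the expanded propagator), and ALL vector legs external (the printed case is `n = 0` A′-legs: *"with external vector
field B′ only"* — the field B′ enters as the external-field legs `n′`, of dimension 0 like the legs of Ã, p. 422; external A′-legs,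
if any, change nothing below).  Its INCIDENCE data (2.1) are therefore: vertices (1.8)–(1.11), no internal vector leg, and
`2·(vertices) − 2` internal φ′-legs — the hypothesis `IsChainLike` of this file; the explicit chains (`ChainData.graph`), their
sub-chains and the verification that they have this incidence are in the sibling `…B3PropagatorChains433Model`.  Vertices of the
form (1.13)–(1.15) occur in such chains only through the PAIRS of p. 414 (*"an expression = scalar product of a pair from
(1.12)–(1.15)"*, one φ′-leg per factor); in the model a pair is two one-leg vertices not joined by a line, and EVERY graph of the
model containing a vertex of the form (1.13)–(1.15) has positive degree in d = 3 and d = 2 (Cor. 2.3 first clause,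
`B3Cor23ConcreteProof.deg_pos_of_hasVertex1315`, `B3Cor23ConcreteTwoDim.deg_pos_of_hasVertex1315`) — so that clause of the sentence
is already a theorem of the tree (`deg_pos_of_hasVertex1315_two_three` records it) and the chain incidence typed here carries the
vertices (1.8)–(1.11).

WHAT THIS MODULE PROVES (sorry-free; `def`s with bodies: `isChainVertex`, `wt`; no `Prop` fact introduced).
(1) `IsChainLike.deg_eq` — for every graph of the model with the incidence of a chain, in EVERY dimension d:
`D(G) = Σ_v w(v) − 2`, `w(v) = (η-count of v) − d + 2 − (differentiations of v acting on internal lines)` ((2.1)/(2.2) summed;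
`wt`).  (2) `one_le_wt`, `wt_le_one_iff` — on the admissible catalogue `w(v) ≥ 1`, with `w(v) = 1` exactly for the vertices (1.8)
with `n + n′ = 1` whose differentiated leg is internal (n̄ ≥ 1).  (3) Hence (`IsChainLike.nV_sub_two_le_deg`, `deg_nonneg`,
`deg_pos_of_three_le_nV`, `shape24_of_deg_nonpos`, `line24_of_deg_nonpos`): `D(G) ≥ (vertices) − 2 ≥ 0`, `D(G) > 0` as soon as
there are three vertices, and `D(G) ≤ 0` forces EXACTLY the graph (2.4): two vertices (1.8) with `n + n′ = 1`, each with exactly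
its differentiated φ′-leg internal, the one line joining the two differentiated legs, `D(G) = 0` — the same description as
`B3Graph24Unique.graph24_unique` (there: d = 3, four external legs; here: every d, chain incidence).  Since a connected subgraph
(with a line) of a chain is again a chain, this is the printed *"every subgraph has positive degree or contains (2.4)"* with the
equality case decided (explicit sub-chains: sibling file).
NOT here (analytic, other rows): *"the estimate (3.2) for them is a consequence of Proposition 2.1"* (rows B3.Prop2.1 / B3.Eq3.2;
the hypothesis `B3Prop1.PosSubgraphsExcept24` of r15's `Prop21` has exactly the shape proved here), the expansion formulas
(I.3.14), (I.3.44)–(I.3.45) themselves, and the rest of the p. 433 narrative (cubes □₁ ⊂ □, the constant field B₀, the gauge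
transformation removing B₀, G_k(□,0) = G_k(0) + δG_k).
-/

namespace Literature.MathematicalPhysics.QuantumFieldTheory.Balaban1983to89.B3PropagatorChains433

open Finset B3Prop1 B3Sect2Statements B3VertexBridge B3Cor23Concrete B3DivergentGraphs

/-! ## The vertices of a chain and their weights -/

/-- p. 433 [PDF 23]: the vertices of a chain of propagators are *"of the form (1.8)–(1.11)"* (two φ′-legs each; the pairs
(1.13)–(1.15) are treated apart, see the module docstring). [cite: Balaban1983Higgs3, p.433] -/
def isChainVertex : VertexKind → Bool
  | .v18 _ _ => true
  | .v19 _ _ => true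
  | .v110 _ _ => true
  | .v111 _ _ => true
  | _ => false

/-- kernel: the vertices (1.8)–(1.11) have two φ′-legs (p. 413). [cite: Balaban1983Higgs3, (1.8)–(1.11) p.413] -/
theorem scalarLegs_of_isChainVertex (v : VertexKind) (h : isChainVertex v = true) : v.scalarLegs = 2 := by
  cases v <;> simp_all [isChainVertex, VertexKind.scalarLegs]

/-- kernel: the vertices (1.8)–(1.11) are not of the form (1.14)–(1.15) (no extra summand in (2.1)). [cite: Balaban1983Higgs3, (2.1) p.422] -/
theorem isAveragingVertex_of_isChainVertex (v : VertexKind) (h : isChainVertex v = true) : v.isAveragingVertex = false := by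
  cases v <;> simp_all [isChainVertex, VertexKind.isAveragingVertex]

/-- kernel: the vertices (1.8)–(1.11) are not of the form (1.13)–(1.15). [cite: Balaban1983Higgs3, Cor. 2.3 p.429] -/
theorem isOfForm1315_of_isChainVertex (v : VertexKind) (h : isChainVertex v = true) : v.isOfForm1315 = false := by
  cases v <;> simp_all [isChainVertex, VertexKind.isOfForm1315]

/-- The weight of a vertex in a chain: `w(v) = (number of factors η in v) − d + 2 − (differentiations of v acting on internal
lines)` — the summand of D(G) + 2 contributed by `v` when (2.1) is summed over a chain ((2.2): `D(G) = Σ_v D_G(v) − d`).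
[cite: Balaban1983Higgs3, (2.1)–(2.2) pp.422–423] -/
def wt (d : ℕ) (v : VertexKind) (δ : ℕ) : ℤ := v.etaCount d - d + 2 - δ

/-- kernel (table (iii)–(iv) p. 423 rearranged): every admissible vertex (1.8)–(1.11) has weight `w(v) ≥ 1` in every dimension —
(1.8): `n + n′ + 1 − δ ≥ n + n′ ≥ 1`; (1.9): `n + n̄ + 2 − δ`; (1.10): `n + n′ ≥ 2`; (1.11): `n + n̄ + 1`.
[cite: Balaban1983Higgs3, p.423] -/
theorem one_le_wt {nbar : ℕ} (d : ℕ) (v : VertexKind) (hc : isChainVertex v = true) (hv : v.Admissible nbar) (δ : ℕ)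
    (hδ : δ ≤ v.diffCount) : 1 ≤ wt d v δ := by
  cases v
  case v18 n n' => simp only [VertexKind.Admissible, VertexKind.etaCount, VertexKind.diffCount, wt] at *; omega
  case v19 n nb => simp only [VertexKind.Admissible, VertexKind.etaCount, VertexKind.diffCount, wt] at *; omega
  case v110 n n' =>
    obtain ⟨-, -, -, h2⟩ := hv
    simp only [VertexKind.etaCount, VertexKind.diffCount, wt] at *; omega
  case v111 n nb => simp only [VertexKind.Admissible, VertexKind.etaCount, VertexKind.diffCount, wt] at *; omega
  all_goals simp [isChainVertex] at hc

/-- kernel: for n̄ ≥ 1 the weight of an admissible vertex (1.8)–(1.11) is `≤ 1` (hence `= 1`) EXACTLY for the vertices (1.8)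
with `n + n′ = 1` whose differentiation acts on an internal line — the vertices of the graph (2.4) (p. 424).
[cite: Balaban1983Higgs3, (2.4) p.424] -/
theorem wt_le_one_iff {nbar : ℕ} (hn : 1 ≤ nbar) (d : ℕ) (v : VertexKind) (hc : isChainVertex v = true)
    (hv : v.Admissible nbar) (δ : ℕ) (hδ : δ ≤ v.diffCount) :
    wt d v δ ≤ 1 ↔ ∃ n n' : ℕ, v = .v18 n n' ∧ n + n' = 1 ∧ δ = 1 := by
  constructor
  · intro h
    cases v
    case v18 n n' =>
      simp only [VertexKind.Admissible, VertexKind.etaCount, VertexKind.diffCount, wt] at *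
      exact ⟨n, n', rfl, by omega, by omega⟩
    case v19 n nb =>
      exfalso; simp only [VertexKind.Admissible, VertexKind.etaCount, VertexKind.diffCount, wt] at *; omega
    case v110 n n' =>
      exfalso
      obtain ⟨-, -, -, h2⟩ := hv
      simp only [VertexKind.etaCount, VertexKind.diffCount, wt] at *; omega
    case v111 n nb =>
      exfalso; simp only [VertexKind.Admissible, VertexKind.etaCount, VertexKind.diffCount, wt] at *; omega
    all_goals simp [isChainVertex] at hc
  · rintro ⟨n, n', rfl, hnn, rfl⟩
    simp only [wt, VertexKind.etaCount]
    omega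

/-! ## Graphs with the incidence of a chain -/

variable {nbar : ℕ}

/-- The incidence of a chain of propagators (p. 433): all vertices of the form (1.8)–(1.11), every vector leg external
(*"with external vector field B′ only"*), and `2·(vertices) − 2` internal φ′-legs — (vertices) − 1 lines joining φ′-legs.
[cite: Balaban1983Higgs3, p.433] -/
structure IsChainLike (G : Graph nbar) : Prop where
  /-- the vertices are of the form (1.8)–(1.11) -/
  kind_chain : ∀ i, isChainVertex (G.kind i) = true
  /-- every vector leg is external -/
  intVector_zero : ∀ i, G.intVector i = 0
  /-- the internal φ′-legs number 2·(vertices) − 2 -/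
  sum_intScalar : ∑ i, G.intScalar i + 2 = 2 * G.nV

namespace IsChainLike

variable {G : Graph nbar} (hG : IsChainLike G)
include hG

/-- kernel: (2.1) at a vertex of a chain-like graph — D_G(v) = (η-count) + (internal φ′-legs)·(2−d)/2 − (internal differentiations).
[cite: Balaban1983Higgs3, (2.1) p.422] -/
theorem vertexDeg_eq (d : ℕ) (i : Fin G.nV) :
    G.vertexDeg d i = ((G.kind i).etaCount d : ℚ) + (G.intScalar i : ℚ) * ((2 - (d : ℚ)) / 2) - (G.intDiffs i : ℚ) := by
  rw [G.vertexDeg_eq d i, hG.intVector_zero i, isAveragingVertex_of_isChainVertex _ (hG.kind_chain i)]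
  simp

/-- **(2.2) summed over a chain**, every dimension d: `D(G) = Σ_v w(v) − 2` with `w(v) = η-count − d + 2 − internal
differentiations` (`wt`). [cite: Balaban1983Higgs3, (2.2) p.423] -/
theorem deg_eq (d : ℕ) : G.deg d = ((∑ i, wt d (G.kind i) (G.intDiffs i) : ℤ) : ℚ) - 2 := by
  have hs : ((∑ i, G.intScalar i : ℕ) : ℚ) + 2 = 2 * (G.nV : ℚ) := by exact_mod_cast hG.sum_intScalar
  push_cast at hs
  have hpt : ∀ i, G.vertexDeg d i =
      (wt d (G.kind i) (G.intDiffs i) : ℚ) + ((G.intScalar i : ℚ) - 2) * ((2 - (d : ℚ)) / 2) := by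
    intro i
    rw [hG.vertexDeg_eq]
    simp only [wt]
    push_cast
    ring
  rw [G.deg_eq, Finset.sum_congr rfl fun i _ => hpt i, Finset.sum_add_distrib, ← Finset.sum_mul,
    Finset.sum_sub_distrib]
  simp only [Finset.sum_const, Finset.card_univ, Fintype.card_fin, nsmul_eq_mul]
  push_cast
  have h2 : (∑ i, (G.intScalar i : ℚ)) = 2 * (G.nV : ℚ) - 2 := by linarith
  rw [h2]
  ring

/-- kernel: a chain-like graph has at least two vertices (its line joins φ′-legs of two vertices). [cite: Balaban1983Higgs3, p.415] -/
theorem two_le_nV : 2 ≤ G.nV := by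
  obtain ⟨⟨i, y⟩, hx⟩ := G.exists_line
  cases y with
  | inl j =>
    have h1 : 1 ≤ G.intScalar i := G.one_le_intScalar j hx
    have hle : G.intScalar i ≤ ∑ l, G.intScalar l :=
      Finset.single_le_sum (fun _ _ => Nat.zero_le _) (Finset.mem_univ i)
    have := hG.sum_intScalar
    omega
  | inr j =>
    have h1 : 1 ≤ G.intVector i := G.one_le_intVector j hx
    have := hG.intVector_zero i
    omega

/-- **p. 433**, the lower bound behind *"every subgraph has positive degree or contains (2.4)"*: for a chain-like graph
`D(G) ≥ (number of vertices) − 2` in every dimension (each vertex has weight ≥ 1). [cite: Balaban1983Higgs3, p.433] -/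
theorem nV_sub_two_le_deg (d : ℕ) : (G.nV : ℚ) - 2 ≤ G.deg d := by
  rw [hG.deg_eq d]
  have h : ∀ i ∈ (univ : Finset (Fin G.nV)), (1 : ℤ) ≤ wt d (G.kind i) (G.intDiffs i) := fun i _ =>
    one_le_wt d _ (hG.kind_chain i) (G.adm i) _ (G.intDiffs_le i)
  have hsum := Finset.sum_le_sum h
  simp only [Finset.sum_const, Finset.card_univ, Fintype.card_fin, nsmul_eq_mul, mul_one] at hsum
  have hsum' : (G.nV : ℚ) ≤ ((∑ i, wt d (G.kind i) (G.intDiffs i) : ℤ) : ℚ) := by exact_mod_cast hsum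
  linarith

/-- **p. 433**: a chain-like graph never has negative degree, in any dimension. [cite: Balaban1983Higgs3, p.433] -/
theorem deg_nonneg (d : ℕ) : 0 ≤ G.deg d := by
  have h2 : (2 : ℚ) ≤ G.nV := by exact_mod_cast hG.two_le_nV
  have := hG.nV_sub_two_le_deg d
  linarith

/-- **p. 433**: a chain-like graph with at least three vertices (two lines) has POSITIVE degree, in any dimension.
[cite: Balaban1983Higgs3, p.433] -/
theorem deg_pos_of_three_le_nV (d : ℕ) (h3 : 3 ≤ G.nV) : 0 < G.deg d := by
  have h3' : (3 : ℚ) ≤ G.nV := by exact_mod_cast h3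
  have := hG.nV_sub_two_le_deg d
  linarith

/-- **p. 433** [PDF 23], verbatim: *"For such chains, every subgraph has positive degree or contains (2.4)"* — the equality case
DECIDED: a chain-like graph with `D(G) ≤ 0` (any dimension d, n̄ ≥ 1) IS the graph (2.4): exactly two vertices, both of the form
(1.8) with `n + n′ = 1`, each with exactly one internal element — its differentiated φ′-leg — and `D(G) = 0` (compare
`B3Graph24Unique.graph24_unique`, the same description obtained in d = 3 from "four external legs").
[cite: Balaban1983Higgs3, p.433] -/
theorem shape24_of_deg_nonpos (hn : 1 ≤ nbar) (d : ℕ) (hD : G.deg d ≤ 0) :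
    G.nV = 2 ∧ (∀ i, ∃ n n' : ℕ, G.kind i = .v18 n n' ∧ n + n' = 1)
      ∧ (∀ i, G.intScalar i = 1 ∧ G.intVector i = 0 ∧ G.intDiffs i = 1) ∧ G.deg d = 0 := by
  have h2 := hG.two_le_nV
  have hlow := hG.nV_sub_two_le_deg d
  have hV : G.nV = 2 := by
    have : (G.nV : ℚ) ≤ 2 := by linarith
    have : G.nV ≤ 2 := by exact_mod_cast this
    omega
  -- the weights sum to at most 2, each is ≥ 1, hence each is exactly 1
  have hwt1 : ∀ i, 1 ≤ wt d (G.kind i) (G.intDiffs i) := fun i =>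
    one_le_wt d _ (hG.kind_chain i) (G.adm i) _ (G.intDiffs_le i)
  have hdeg := hG.deg_eq d
  have hsumle : ((∑ i, wt d (G.kind i) (G.intDiffs i) : ℤ) : ℚ) ≤ 2 := by linarith
  have hsumle' : (∑ i, wt d (G.kind i) (G.intDiffs i) : ℤ) ≤ 2 := by exact_mod_cast hsumle
  have hsumge : (2 : ℤ) ≤ ∑ i, wt d (G.kind i) (G.intDiffs i) := by
    have := Finset.sum_le_sum fun i (_ : i ∈ (univ : Finset (Fin G.nV))) => hwt1 i
    simp only [Finset.sum_const, Finset.card_univ, Fintype.card_fin, nsmul_eq_mul, mul_one, hV] at this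
    exact_mod_cast this
  have hsum2 : (∑ i, wt d (G.kind i) (G.intDiffs i) : ℤ) = 2 := le_antisymm hsumle' hsumge
  have heach : ∀ i, wt d (G.kind i) (G.intDiffs i) = 1 := by
    have heq : ∑ i, wt d (G.kind i) (G.intDiffs i) = ∑ _i : Fin G.nV, (1 : ℤ) := by
      rw [hsum2]; simp [hV]
    intro i
    exact ((Finset.sum_eq_sum_iff_of_le fun j (_ : j ∈ (univ : Finset (Fin G.nV))) => hwt1 j).mp heq.symm i
      (Finset.mem_univ i)).symm
  have hkindδ : ∀ i, (∃ n n' : ℕ, G.kind i = .v18 n n' ∧ n + n' = 1) ∧ G.intDiffs i = 1 := by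
    intro i
    obtain ⟨n, n', hk, hnn, hδ⟩ := (wt_le_one_iff hn d _ (hG.kind_chain i) (G.adm i) _ (G.intDiffs_le i)).mp
      (heach i).le
    exact ⟨⟨n, n', hk, hnn⟩, hδ⟩
  -- each vertex has at least one internal φ′-leg (its differentiated leg), and there are two in all
  have hsc : ∀ i, 1 ≤ G.intScalar i := fun i => by
    obtain ⟨h0, hs⟩ := B3Graph24Unique.isSome_of_intDiffs_pos G (i := i) (by rw [(hkindδ i).2]; exact Nat.one_pos)
    exact G.one_le_intScalar _ hs
  have hsum : ∑ i, G.intScalar i = 2 := by have := hG.sum_intScalar; omega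
  have hone : ∀ i, G.intScalar i = 1 := by
    have heq : ∑ _i : Fin G.nV, (1 : ℕ) = ∑ i, G.intScalar i := by
      rw [hsum]; simp [hV]
    exact fun i => ((Finset.sum_eq_sum_iff_of_le fun j (_ : j ∈ (univ : Finset (Fin G.nV))) => hsc j).mp heq i
      (Finset.mem_univ i)).symm
  exact ⟨hV, fun i => (hkindδ i).1, fun i => ⟨hone i, hG.intVector_zero i, (hkindδ i).2⟩,
    le_antisymm hD (hG.deg_nonneg d)⟩

/-- The picture (2.4) recovered for a chain-like graph with `D(G) ≤ 0`: the differentiated φ′-leg (leg 0) of every vertex lies on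
a line whose other endpoint is the differentiated φ′-leg of the OTHER vertex, and no other leg is internal (cf.
`B3Graph24Unique.graph24_unique_line`). [cite: Balaban1983Higgs3, (2.4) p.424] -/
theorem line24_of_deg_nonpos (hn : 1 ≤ nbar) (d : ℕ) (hD : G.deg d ≤ 0) (i : Fin G.nV) :
    (∃ (h0 : 0 < (G.kind i).scalarLegs) (j : Fin G.nV) (h0' : 0 < (G.kind j).scalarLegs),
        j ≠ i ∧ G.other ⟨i, .inl ⟨0, h0⟩⟩ = some ⟨j, .inl ⟨0, h0'⟩⟩)
      ∧ ∀ x : Leg G.kind, x.1 = i → (G.other x).isSome → ∃ h0 : 0 < (G.kind i).scalarLegs, x = ⟨i, .inl ⟨0, h0⟩⟩ := by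
  obtain ⟨-, -, hinc, -⟩ := hG.shape24_of_deg_nonpos hn d hD
  have key : ∀ (i : Fin G.nV) (j : Fin (G.kind i).scalarLegs), (G.other ⟨i, .inl j⟩).isSome → j.val = 0 := by
    intro i j hj
    by_contra hne
    obtain ⟨h0, hs0⟩ := B3Graph24Unique.isSome_of_intDiffs_pos G (i := i) (by rw [(hinc i).2.2]; exact Nat.one_pos)
    have hne' : (⟨0, h0⟩ : Fin (G.kind i).scalarLegs) ≠ j := fun h => hne (by rw [← h])
    have := B3DivergentGraphs.two_le_intScalar G ⟨0, h0⟩ j hne' hs0 hj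
    have := (hinc i).1
    omega
  constructor
  · obtain ⟨h0, hs0⟩ := B3Graph24Unique.isSome_of_intDiffs_pos G (i := i) (by rw [(hinc i).2.2]; exact Nat.one_pos)
    obtain ⟨y, hy⟩ := Option.isSome_iff_exists.mp hs0
    obtain ⟨j, j', rfl, hy'⟩ := G.other_scalar hy
    have hj0 := key j j' (by simp [hy'])
    have h0' : 0 < (G.kind j).scalarLegs := by have := j'.isLt; omega
    have hjj : j' = ⟨0, h0'⟩ := Fin.ext hj0
    subst hjj
    refine ⟨h0, j, h0', fun h => ?_, hy⟩
    subst h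
    exact G.other_ne _ _ hy rfl
  · rintro ⟨i', y⟩ rfl hx
    cases y with
    | inl j =>
      have hj0 := key _ j hx
      have h0 : 0 < (G.kind i').scalarLegs := by have := j.isLt; omega
      exact ⟨h0, by rw [show j = ⟨0, h0⟩ from Fin.ext hj0]⟩
    | inr j =>
      have := G.one_le_intVector j hx
      have := (hinc i').2.1
      omega

end IsChainLike

/-! ## The (1.13)–(1.15) clause -/

/-- p. 433: chains may also pass through the pairs (1.13)–(1.15) of p. 414.  In the model EVERY graph with a vertex of the form
(1.13)–(1.15) — in particular every connected piece of such a chain containing the pair — has positive degree, d = 3 and d = 2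
(Cor. 2.3, first clause; seat p18 gen 1, by name). [cite: Balaban1983Higgs3, Cor. 2.3 p.429] -/
theorem deg_pos_of_hasVertex1315_two_three (G : Graph nbar) (h : G.HasVertex1315) : 0 < G.deg 3 ∧ 0 < G.deg 2 :=
  ⟨B3Cor23ConcreteProof.deg_pos_of_hasVertex1315 G h, B3Cor23ConcreteTwoDim.deg_pos_of_hasVertex1315 G h⟩

end Literature.MathematicalPhysics.QuantumFieldTheory.Balaban1983to89.B3PropagatorChains433
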